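import Mathlib
import HarnessLib
import HarnessLib.Audit
import Summits.PneNP.Statement
import Literature.Computability.Complexity.Classes
import Literature.Computability.Complexity.BoolEncodings
import Literature.Computability.Complexity.StackLists
import Literature.Computability.Complexity.CircuitEval
import Literature.Computability.Complexity.CNF
import Literature.Computability.MetaComplexity.Resolution
import Literature.Computability.MetaComplexity.PolynomialCalculus
import Literature.Computability.Complexity.TFNPProblems
import Literature.Computability.Complexity.TFNPClasses
import HarnessLib.Audit.Status.Attr

/-!
Route: ArnoldMorseDeficit

DORMANT since 2026-08-23T10:47:02Z (reconciler: no traction for 6 d (last activity item-evidence-added at 2026-08-17T08:39:09Z); parked, not closed — `ledger route dormant route-PneNP-ArnoldMorseDeficit --off` to reactivate) — unstaffed, not closed; items shared with open routes are served there. `ledger route dormant <id> --off` reactivates.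

# Route ArnoldMorseDeficit — P ≠ NP if the critical cells that homology promises — and Euler,
pigeonhole and parity do not — cannot be found in polynomial time (MORSE-DEFICIT ∉ FP)

It suffices to show X = MORSE-DEFICIT ∉ FP (card PneNP/PneNP/arnold-torus-homological-totality, its
K4/"X itself"): no polynomial-time
string function maps every valid instance (n, m, D, Λ) to the code of a solution, where an instance
is a SUCCINCT DISCRETE MORSE FUNCTION f on the
cubical complex of the torus T^n_N = (ℤ/2^m)^n (cells (v,S) = v + [0,1]^S; f(cell) = the number
whose j-th bit is the answer of the tree's proved
poly-time universal evaluator `CircEval.evalFn` on program D_j and the cell's code) together with a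
list Λ of fewer than 2^n = Σ_k b_k(T^n; 𝔽₂)
cell codes, and a solution is a valid cell that (a) is critical (Forman) and unlisted, or (b)
violates Forman's local Morse condition, or (c) is
listed but not critical. Totality is the weak Morse inequality #crit_k ≥ b_k (Forman 1998, Cor. 3.7)
— HOMOLOGICAL RANK, with zero Euler /
Lefschetz bookkeeping in the balanced regime; the continuous shadow is Conley–Zehnder's theorem
(Arnold's conjecture on T^2n: a Hamiltonian map
has ≥ 2n+1 fixed points although L(F) = χ = 0). X ⇒ PneNP because P = NP puts every P-checkable
total search problem in FP (tree:
`exists_searchFn_of_NP_subset_P`, proved) and the solution relation is in P (support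
MorseDeficitCheckP) and total (support MorseDeficitTotal).
Lean: `let bp := Literature.Computability.Complexity.boolPair; let ev :=
Literature.Computability.Complexity.CircEval.evalFn; let el :=
Literature.Computability.Complexity.encList; let cellBits : (n m : ℕ) → ((Fin n → ℕ) × (Fin n →
Bool)) → List Bool := fun n m c => (List.ofFn fun i : Fin n => List.ofFn fun j : Fin m => (c.1
i).testBit j).flatten ++ List.ofFn c.2; let val : (n m : ℕ) → List (List Bool) → ((Fin n → ℕ) × (Fin
n → Bool)) → ℕ := fun n m D c => ((List.finRange D.length).map fun j => if ev (bp (cellBits n m c)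
(D.get j)) = [true] then 2 ^ (j : ℕ) else 0).sum; let facets : (n m : ℕ) → ((Fin n → ℕ) × (Fin n →
Bool)) → List ((Fin n → ℕ) × (Fin n → Bool)) := fun n m c => (List.finRange n).flatMap fun i => if
c.2 i then [(c.1, update c.2 i false), (update c.1 i ((c.1 i + 1) % 2 ^ m), update c.2 i false)]
else []; let cofacets : (n m : ℕ) → ((Fin n → ℕ) × (Fin n → Bool)) → List ((Fin n → ℕ) × (Fin n →
Bool)) := fun n m c => (List.finRange n).flatMap fun i => if c.2 i then [] else [(c.1, update c.2 i
true), (update c.1 i ((c.1 i + 2 ^ m - 1) % 2 ^ m), update c.2 i true)]; let upBad : (n m : ℕ) →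
List (List Bool) → ((Fin n → ℕ) × (Fin n → Bool)) → ℕ := fun n m D c => ((cofacets n m c).filter fun
τ => decide (val n m D τ ≤ val n m D c)).length; let downBad : (n m : ℕ) → List (List Bool) → ((Fin
n → ℕ) × (Fin n → Bool)) → ℕ := fun n m D c => ((facets n m c).filter fun ν => decide (val n m D c ≤
val n m D ν)).length; let IsSol : (I : ℕ × ℕ × List (List Bool) × List (List Bool)) → ((Fin I.1 → ℕ)
× (Fin I.1 → Bool)) → Prop := fun I c => (∀ i, c.1 i < 2 ^ I.2.1) ∧ (¬ (upBad I.1 I.2.1 I.2.2.1 c ≤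
1 ∧ downBad I.1 I.2.1 I.2.2.1 c ≤ 1) ∨ (upBad I.1 I.2.1 I.2.2.1 c = 0 ∧ downBad I.1 I.2.1 I.2.2.1 c
= 0 ∧ cellBits I.1 I.2.1 c ∉ I.2.2.2) ∨ (¬ (upBad I.1 I.2.1 I.2.2.1 c = 0 ∧ downBad I.1 I.2.1
I.2.2.1 c = 0) ∧ cellBits I.1 I.2.1 c ∈ I.2.2.2)); let Valid : (ℕ × ℕ × List (List Bool) × List
(List Bool)) → Prop := fun I => 1 ≤ I.2.1 ∧ I.2.2.2.length < 2 ^ I.1; let encI : (ℕ × ℕ × List (List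
Bool) × List (List Bool)) → List Bool := fun I => bp (Computability.unaryEncodeNat I.1) (bp
(Computability.unaryEncodeNat I.2.1) (bp (el I.2.2.1) (el I.2.2.2))); ¬ ∃ g ∈
Literature.Computability.Complexity.FP, ∀ I, Valid I → ∃ c : (Fin I.1 → ℕ) × (Fin I.1 → Bool),
cellBits I.1 I.2.1 c = g (encI I) ∧ IsSol I c`

## Assembly
Deciding theorem (glue.lean, pure logic): `closes (hT : MorseDeficitTotal) (hC : MorseDeficitCheckP)
(hX : MorseDeficitHard) (hA : Assembly) :
PneNP := hA hT hC hX`. The item Assembly is PROVABLE NOW from proved tree facts: assume ¬PneNP, i.e.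
every Wave0-NP language over Bool is in
Wave0-P; the proved model bridges P_bool_eq_holds / NP_bool_eq_holds (used inside the proof, not
imported by the route file, so no conjecture
leaf enters the cone) give Nondeterministic.NP ⊆ Classes.P; `exists_searchFn_of_NP_subset_P`
(Arora–Barak Thm 2.18, proved in
SearchToDecision.lean) applied to R ∈ P (hC) and p = X² yields g ∈ FP with ⟨x, g x⟩ ∈ R whenever
some short y has ⟨x, y⟩ ∈ R; for x = code I
with I valid, hT and |code c| = n·m + n ≤ |code I|² supply such y; injectivity of boolPair / unary /
encList identifies I, so g solves every
valid instance — contradicting hX. The cruxes 2–4 are rungs and calibrations of X (2: X ⟸ CLS ⊄ FP;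
3, 4: X holds against potential and parity
arguments in the black-box model); none is smuggled into the deciding theorem.

Rationale: WHY THIS LINE. Read the Morse inequalities / Arnold conjecture on tori as a TOTALITY PRINCIPLE and
bet that it is a TFNP species outside the potential (PLS),
parity (PPA ⊇ PPAD ⊇ CLS) and — conjecturally — pigeonhole families; P ≠ NP follows from its
hardness exactly as from any TFNP ⊄ FP statement
(doi:10.1016/0304-3975(91)90200-l, doi:10.1016/s0022-0000(05)80063-7), the folklore arrow being
declared, not claimed. Imported areas, with an
exact dictionary: discrete Morse theory on regular CW complexes (doi:10.1006/aima.1997.1650: Forman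
conditions ↦ locally checkable solution types,
weak Morse inequalities ↦ totality, gradient V-paths ↦ the only paths there are, all f-decreasing),
symplectic fixed-point theory as motivation and
future dictionary item (doi:10.1007/bf01393824, Chaperon 1984 broken geodesics), and the TFNP^dt ↔
propositional-proof dictionary
(doi:10.4230/lipics.itcs.2019.38, doi:10.4230/lipics.itcs.2023.30, arXiv:2205.02168: PLS^dt ↔
polylog Resolution width, PPA^dt ↔ polylog
𝔽₂-Nullstellensatz degree) which turns "new species" into two typed, two-sided proof-complexity
statements (cruxes 3, 4). Planner's corrections
to the card (NOTES.md §Design record): (i) the card's T² showcase is degenerate — on T² every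
admissible list either omits a minimum or a
maximum (ascent/descent along non-branching dual V-paths = PLS finds the missing one) or is
Euler-unbalanced (χ-counting = multi-source
END-OF-LINE, arXiv:1902.07657); the first genuinely homological regime is T³ with a balanced list
containing a min and a max, e.g. the origin
flag Λ₀ = (vertex, edge, square, cube) forced by b₁(T³) = 3, or two minima + two maxima forced by b₀
(mountain pass) — all restricted-model
cruxes live there; (ii) because f strictly decreases along V-paths, END-OF-LINE lines cannot be
embedded as gradient corridors (values would
encode positions along the line), but END-OF-POTENTIAL-LINE lines can: the right hardness rung is
CLS (arXiv:1811.03841, arXiv:2202.07761,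
doi:10.1145/3568163), crux 2, giving X ⟸ CLS ⊄ FP (believed: doi:10.1137/17m1118014,
doi:10.1145/3313276.3316400, doi:10.1109/focs.2015.94).
No prior route of this summit uses a topological existence theorem as its source of totality
(DirichletPigeons: pigeonhole/PPP; the four
negatives are untouched).

RANKED CRUXES. #0 MorseDeficitHard (target) — X — no g ∈ FP solves MORSE-DEFICIT: for every
polynomial-time string function g there is a valid instance I = (n, m ≥ 1, programs D, list Λ with
|Λ| < 2^n) such that g(code I) is not the code of a solution cell (critical ∧ unlisted, or
Morse-violating, or listed ∧ non-critical). Instance code = ⟨1^n, ⟨1^m, ⟨encList D, encList Λ⟩⟩⟩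
(boolPair, unary n and m so that cell codes, of length n·m + n, are polynomially bounded). (why it
might fail: It is an FP ≠ TFNP statement, so only conditional (crux 2 + CLS ⊄ FP) or
restricted-model (cruxes 3, 4) evidence is reachable; false iff unlisted critical cells of every
succinct discrete Morse function can be found in poly time, e.g. if one always lies poly-close to
Λ.) [doi:10.1016/0304-3975(91)90200-l, doi:10.1016/s0022-0000(05)80063-7,
doi:10.1006/aima.1997.1650, arXiv:1902.07657, doi:10.1145/3568163, doi:10.1137/17m1118014]
#2 EoplToMorseDeficit (crux) — CLS-HARDNESS — END-OF-POTENTIAL-LINE (Fearnley–Gordon–Mehta–Savani: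
successor/predecessor/potential programs S, P, V on {0,1}^k, P(0^k) = 0^k ≠ S(0^k); solutions:
S(P(x)) ≠ x ≠ 0^k, or P(S(x)) ≠ x, or an edge x → S(x) with P(S(x)) = x along which V does not
increase) Karp-reduces to MORSE-DEFICIT: there are φ, ψ ∈ FP such that φ maps the code of every
valid EOPL instance to the code of a valid MORSE-DEFICIT instance and ψ maps every solution cell of
the image (paired with the EOPL code) to an EOPL solution. Intended construction: background = a
perfect discrete Morse function on T³_N, Λ = its 7 critical cells other than the minimum; the basin
of the minimum is re-landscaped into a bowl draining into the standard line's groove; lines =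
f-decreasing gradient corridors (values from the potential), tails = pits (critical vertices),
non-standard heads = saddle gadgets (critical edges); Euler bookkeeping t pits ⇔ t − 1 new saddles
matches exactly. Consequence: X ⟸ CLS ⊄ FP. [difficulty: L] (why it might fail: The surgery must
leave ONE globally acyclic discrete Morse function: corridor tubes glued into the perfect background
gradient may force spurious critical cells at corners / wall seams that ψ cannot map to EOPL
solutions, and every bogus potential edge must surface as a pit or saddle.) [arXiv:1811.03841,
doi:10.1016/j.jcss.2020.05.007, arXiv:2202.07761, doi:10.1145/3568163, arXiv:1902.07657,
doi:10.1006/aima.1997.1650, doi:10.1016/j.tcs.2009.07.052]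
#3 MorseTautResWidth (crux) — NOT A POTENTIAL ARGUMENT — the Morse tautologies on T³ in the balanced
regime need super-polylogarithmic Resolution width: for every a there is m₀ such that for all m ≥ m₀
every Resolution refutation of MorseCNF(m) has width > m^a. MorseCNF(m): variables x_(c,j) = bit j <
3m+3 of f(c), c a cell of the cubical T³ with N = 2^m; for every cell c one clause excluding each
assignment of the 7(3m+3) variables of c and its 6 incident cells that violates "f is discrete-Morse
at c ∧ (c ∈ Λ₀ ↔ c is critical)", Λ₀ = the origin flag (vertex 0, edge 0+[0,1]e₀, square, cube);
unsatisfiable for m ≥ 1 since b₁(T³; 𝔽₂) = 3 forces ≥ 3 critical edges while Euler characteristic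
and min/max search force nothing. By the TFNP^dt dictionary (PLS^dt = polylog-width Resolution) this
says MORSE-DEFICIT^dt(T³, Λ₀) ∉ PLS^dt although every V-path descends. [difficulty: L] (why it might
fail: False iff a potential-guided walk from the flag with a LOCALLY computable exit rule (e.g.
along the separatrices of the listed edge/square) always reaches an unlisted critical cell — a
PLS^dt algorithm = polylog-width refutation; and width technology (boundary expansion) may not see
homology.) [doi:10.4230/lipics.itcs.2023.30, doi:10.4230/lipics.itcs.2019.38, arXiv:2205.02168,
doi:10.1017/jsl.2013.37, BenSassonWigderson2001, doi:10.1006/jcss.1998.1575,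
KrajicekProofComplexity2019]
#4 MorseTautPCDegree (crux) — NOT A PARITY ARGUMENT — for every a there is m₀ such that for all m ≥
m₀ the clause polynomials of MorseCNF(m) (clause C ↦ Π_(x,b)∈C (b ? 1 − x : x), Boolean axioms free)
have no polynomial-calculus refutation over 𝔽₂ of degree ≤ m^a; a fortiori no polylog-degree
𝔽₂-Nullstellensatz refutation, i.e. MORSE-DEFICIT^dt(T³, Λ₀) ∉ PPA^dt ⊇ PPAD^dt ⊇ CLS^dt by the
dictionary. With crux 3: homological-rank totality is reducible to neither potential nor parity
arguments in the black-box world — the provable content of "new species" (the refuter's PPA flag,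
settled in the right arena). [difficulty: L] (why it might fail: Morse inequalities over F2 ARE
linear algebra: a low-degree PC/F2 simulation of Forman's flow on short V-paths, or a PPA walk on a
double cover (h-parity exits), would give polylog degree; and degree lower bounds here need
pseudo-ideal arguments unknown for nested path structures.) [doi:10.4230/lipics.itcs.2019.38,
doi:10.1006/jcss.1998.1575, arXiv:2205.02168, KrajicekProofComplexity2019,
doi:10.1016/j.apal.2012.01.015, doi:10.4230/lipics.itcs.2023.30]
#9 MorseDeficitTotal (support) — TOTALITY — every valid instance has a solution: if no valid cell
violates Forman's condition then f is a discrete Morse function on the cubical complex of T^n_(2^m)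
(regular CW for m ≥ 1), so #critical cells ≥ Σ_k b_k(T^n; 𝔽₂) = 2^n > |Λ| (Forman 1998 Cor. 3.7 weak
Morse inequalities; Künneth), and cell codes are injective on valid cells. Needs cellular homology
of the cubical torus over 𝔽₂ (not in Mathlib) — heavy but classical; it is the existence lemma of
the whole line. [difficulty: XL] [doi:10.1006/aima.1997.1650, doi:10.1142/9360,
doi:10.1016/s0012-365x(99)00258-7]
#9 MorseDeficitCheckP (support) — MEMBERSHIP — the solution relation R = {⟨code I, code c⟩ | I
valid, c a solution of I} is in Classes.P: unpair, parse ⟨1^n,⟨1^m,⟨encList D, encList Λ⟩⟩⟩ (reject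
non-codewords), read c from its n·m + n bits, evaluate the |D| programs on c and its ≤ 2n incident
cells with the proved poly-time evaluator (CircEval.evalFn_mem_FP), compare, count, test membership
in Λ. Pure TM/stack-program plumbing in the style of the tree's Com.mem_FP developments.
[difficulty: L] [AroraBarak2009, Literature.Computability.Complexity.CircEval.evalFn_mem_FP,
Literature.Computability.Complexity.mem_P_of_mem_FP]
#9 MorseDeficitQueryDepth (support) — FIRST RUNG (special case of the spirit of crux 3, in the
decision-tree model): there is κ > 0 such that for all large m every adaptive query algorithm that
reads Λ₀ for free, queries at most 2^(κm) values of f on cells of T³_(2^m) and outputs a cell fails,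
on some discrete Morse function f with the flag Λ₀ critical, to output an unlisted critical cell. An
adversary ("hide the saddles") argument extending local-search lower bounds to the regime where min
and max are known; the cheapest theorem of the line and its cheapest falsifier arena. [difficulty:
M] (why it might fail: Fails if every discrete Morse function on T³ with the flag critical has an
unlisted critical cell within poly(m) V-path steps of the separatrices of the listed edge and square
(then follow them).) [doi:10.1137/17m1118014, doi:10.1016/0166-218x(89)90025-5,
doi:10.1007/s00453-008-9169-z, doi:10.1214/aop/1176993605]

TWO-LAYER PLAN. Foreseen glued splits (filed only when a crux closes or stalls with a census):
EoplToMorseDeficit ⇐ CorridorGadgets (a finite catalogue of local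
re-pairings of the product gradient on T³: straight tube, corner, pit, saddle-head, bowl) →
LayoutAndValues (FP layout of {0,1}^k-indexed boxes and
lanes in T³_(2^poly(k)), values from the potential) → EoplToMorseDeficit; MorseTautResWidth ⇐
DtReductionLowerBound (no polylog-depth decision-tree
Turing reduction from MD^dt(T³,Λ₀) to ITER) → WidthFromDt (BFI23/BKT14 dictionary instance for this
CNF) → MorseTautResWidth; MorseTautPCDegree ⇐
same shape with 𝔽₂-NS/PC and LEAF. Informal items filed right after open: crux 5
ArnoldTorusDictionary (ε-fixed points of gradient-Feistel
compositions on T^2n ↔ MORSE-DEFICIT via Chaperon's discrete action functional), definition requests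
(discrete Morse functions, cubical torus
homology, search problems / EOPL / CLS, Hamiltonian shear circuits) and cite facts (Forman Cor. 3.7,
Conley–Zehnder Thm 1, EOPL = CLS, the dt dictionary).

KILL CRITERIA. A polynomial-time algorithm for MORSE-DEFICIT (¬MorseDeficitHard, e.g. via an
LLL-style structural shortcut on cubical tori) closes the route
`refuted:MorseDeficitHard`. ¬EoplToMorseDeficit cannot be proved outright (it would separate FP from
CLS), but an `exhausted` census showing the
corridor surgery forces uncontrolled critical cells pivots crux 2 to PLS-hardness-with-lists (ITER ≤
MD with Λ = ∅ made informative) and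
weakens the evidence for X to the restricted models. Polylog-WIDTH Resolution refutations of
MorseCNF (¬MorseTautResWidth) = MD is a disguised
local-search problem: the "new species" story dies, X survives only as "PLS ⊄ FP in Morse clothing"
— close `superseded` in favour of a CLS/PLS
card unless crux 2 has landed. Polylog-DEGREE PC/𝔽₂ refutations (¬MorseTautPCDegree) with crux 3
intact = MD is parity-reducible (the refuter's
PPA flag confirmed one dimension up): keep the route (X untouched, PPAD ⊄ FP-type support), record
the membership, re-grade novelty to variant.
A 2^(o(m))-query algorithm in the flag regime (¬MorseDeficitQueryDepth) refutes cruxes 3 and 4 at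
once (depth ⇒ width/degree) and retires the line.

NOT DECOMPOSED YET. No gadget catalogue for crux 2 (layer 2); no PPP / PPADS side (unary-NS /
pigeonhole dictionary) — deliberately open; no Turing-closure
statement "MD^dt ∉ the closure of PLS ∪ PPA ∪ PPP" (needs a dt-reduction formalism the tree lacks);
no continuous ARNOLD-TORUS instance format
(definition request; crux 5 stays informal until it lands); no uniqueness/UEOPL variant; no
average-case or cryptographic hardness of
MORSE-DEFICIT (would follow from crux 2 + iterated-squaring assumptions, prose only); no
per-dimension version MD_k (find a critical k-CELL),
which is the natural home of cup-length vs. Betti-sum distinctions; general n kept in X but every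
restricted-model item is pinned to T³.

CHEAPEST FALSIFIER. Run first: (1) exhibit a polylog-width Resolution refutation — equivalently a
black-box local-search procedure — for MorseCNF(m) with the origin
flag: the one candidate I could not kill by hand is "follow the two descending separatrices of the
listed edge e and the ascending co-paths of the
listed square q and branch at every square by a fixed geometric exit rule"; by hand (NOTES.md) every
fixed exit rule dead-ends at edges paired
DOWN with vertices, which are not solutions, so it is not a PLS reduction — a refuter should try to
repair it with the 𝔽₂ h-parity labels on a
double cover (that would instead give PPA membership and kill crux 4, not 3). (2) m = 1, 2 sanity by
kit/SAT solver: MorseCNF(1) (N = 2, 64 cells,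
6-bit values) is unsatisfiable and small enough to measure actual Resolution width/PC degree trends
for m = 1, 2, 3 — not run here (hub is
compute-free for planners; recorded for the refuter). (3) Literature: any TFNP classification of
"find another critical point / mountain pass
given the minima" — zbMATH/galaxy searches found none (see Novelty).

NUMBERS. Σ_k b_k(T^n; 𝔽₂) = 2^n; T³: b = (1,3,3,1), cells 8N³, N = 2^m, value bits 3m+3, CNF block =
7 cells × (3m+3) bits = 21m+21 variables, so
MorseCNF(m) has ≤ 8N³ · 2^(21m+21) = 2^(24m+24) clauses of width 21m+21 (quasi-polynomial in N,
polylog width — the dt regime). Conley–Zehnder: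
≥ 2n+1 fixed points on T^2n (≥ 2^2n if non-degenerate). Dictionary thresholds: PLS^dt =
polylog(N)-width Resolution, PPA^dt = polylog-degree
𝔽₂-NS (GKRS19 §1, BFI23). Known query bounds for plain local search on [N]^d grids: Ω(N^(d/2))-type
randomized (Aldous, Zhang, Sun–Yao),
deterministic Θ(N^(d−1))-type (LTT89) — exponential in m; CLS/EOML query lower bound 2^Ω(n)
(Hubáček–Yogev). Items at open: 8 (1 target, 3 cruxes, 3 supports, 1 assembly).

DEFINITION REQUESTS. Filed right after open (ledger workitem add --kind definition): (D1)
`DiscreteMorseFunction` / `IsCritical` / discrete gradient and V-paths on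
the face poset of a finite regular CW complex (Forman 1998 §2), topic Literature/AlgebraicTopology;
(D2) `CubicalTorusComplex n N` with its
cellular 𝔽₂-homology, b_k = C(n,k) (for MorseDeficitTotal), same topic; (D3) `SearchProblem`
(P-checkable, polynomially bounded relation),
`TotalSearchProblem`, Karp reductions between search problems, END-OF-LINE / END-OF-POTENTIAL-LINE /
ITER and the classes PPAD, PLS, CLS, topic
Literature/Computability/Complexity (would let X, crux 2 and DirichletPigeons' C2 be restated over
shared vocabulary); (D4) `HamShearComposition`
(syntactic gradient-Feistel circuits x ↦ x + ∇W(y), y ↦ y + ∇V(x) on T^2n over dyadic fixed-point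
arithmetic) and `ArnoldTorusInstance ε`, topic
Summits/PneNP/PneNP/Theorems (posited object for crux 5). Cite facts wanted (kind cite): Forman 1998
Cor. 3.7 (weak Morse inequalities, any
field); Conley–Zehnder 1983 Thm 1; EOPL = CLS = PPAD ∩ PLS (arXiv:2202.07761 Thm 1;
doi:10.1145/3568163); the dt dictionary rows PLS ↔ Resolution
width and PPA ↔ 𝔽₂-NS degree (doi:10.4230/lipics.itcs.2019.38 §1; doi:10.4230/lipics.itcs.2023.30).

Novelty: Searches (2026-08-15, this seat; local searchd/hybrid rc 75 and arXiv/OpenAlex/S2 rate-limited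
during the session, so zbMATH + galaxy): zbMATH
"discrete Morse function critical cells TFNP" (0), "discrete Morse complexity critical" (8:
Lovász-extension Morse theory arXiv:2003.06021,
optimal simplification arXiv:1001.1269, contour trees — no search-problem reading), "Morse
inequalities proof complexity" (2, Farber robotics —
unrelated), "computational complexity saddle point Morse index" (0), "mountain pass computational
complexity" (0 relevant), "total search problem
homology" (0 relevant), "PPAD Betti number" (0 relevant), "complexity finding critical points
discrete Morse" (0), "Arnold conjecture torus fixed
points algorithm" (0), "Conley Zehnder fixed points torus Hamiltonian" (8, all symplectic: Zehnder
ICM86, Floer–Zehnder, Hofer–Zehnder, Chaperon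
1985 — none computational), "Forman Morse theory cell complexes" (8, the theory itself); reference
confirmations for FGMS (arXiv:1811.03841), GHJMPRT
(arXiv:2202.07761, arXiv:2205.02168), GKRS19, BFI23 (doi:10.4230/lipics.itcs.2023.30),
Li–Pires–Robere ITCS24 (intersection classes), Davis–Robere
CCC23 (colourful TFNP), Hubáček–Yogev, BCEIP98, Buss–Johnson 2012, BKT14, Goldberg–Hollender,
Chen–Deng, CHKPRR19, BPR15, LTT89, Santha–Szegedy;
`lit galaxy search --star all` "discrete Morse function" (13: computational-topology volumes,
Scoville's book, Lewiner–Lopes–Tavares optimality —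
explicit complexes, optimisation, no totality re  [refs: 10.4230/lipics.itcs.2023.30, 10.1145/3568163, 10.4230/lipics.itcs.2019.38, 10.1006/aima.1997.1650, 10.1007/bf01393824, 2003.06021, 1001.1269, 1811.03841, 2202.07761, 2205.02168, 1902.07657, doi:10.4230/lipics.itcs.2023.30, doi:10.1145/3568163, doi:10.4230/lipics.itcs.2019.38, doi:10.1006/aima.1997.1650, doi:10.1007/bf01393824]

Barriers (technique_class: tfnp-totality, discrete-morse, proof-complexity): - technique_class: tfnp-totality, discrete-morse, proof-complexity
- Literature.Barriers.PneNP.Relativization: binds the thesis-level step only: X ⇒ PneNP composes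
with any proof of X to a non-relativizing proof, so X itself is out of reach of relativizing
methods; not evaded — the bet is that the provable content (crux 2: an explicit white-box reduction;
cruxes 3–4: oracle-world = proof-complexity lower bounds, which is exactly where relativized
separations ARE theorems) is informative about this specific principle, and no mechanism from the
rungs to all Turing machines is claimed.
- Literature.Barriers.PneNP.BoundedRelativization: same status as Relativization (binds X ⇒ PneNP;
silent on cruxes 2–4, which are an FP reduction and two propositional lower bounds).
- Literature.Barriers.PneNP.Algebrization: same status — a proof of X must be non-algebrizing;
cruxes 3–4 are black-box statements to which algebrization is irrelevant, crux 2 is a reduction.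
- Literature.Barriers.PneNP.NaturalProofs: not applicable — uniform total search problems and
propositional width/degree lower bounds; no constructive/large property of Boolean functions is used
or produced.
- Literature.Barriers.PneNP.LatticeGapCoNP: its moral is built in: MORSE-DEFICIT ∈ TFNP cannot be
NP-hard under many-one reductions unless NP = coNP (Megiddo–Papadimitriou), which is why X is argued
through totality-class structure (CLS-hardness, non-membership in PLS/PPA) and never through
NP-hardness gadgets.
- Literature.

History (route lifecycle, newest last):
- 2026-08-16T04:13:45Z · AUTO-CRUX (backfill): MorseDeficitHard — hypotheses of the deciding theorem that nothing in the route derives are cruxes (operator:999:1085951)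
- 2026-08-17T03:45:48Z · rev 5: restated EoplHard (stmt-PneNP-18975) — route-repair (cone): EoplHard restated 1:1 — field notation unfolded, the same Prop definitionally — to narrow the route import Literature.Computability.Complex (planner-rrepair-PneNP-ArnoldMorseDeficit-9947a87f-0)
- 2026-08-17T03:47:00Z · rev 6: dropped stmt-PneNP-18975 — route-repair (cone), follow-up to rev 5: purge the REPLACED record of the old EoplHard item stmt-PneNP-18975 (already closed retired, superseded 1:1 by stmt-Pne (planner-rrepair-PneNP-ArnoldMorseDeficit-9947a87f-0)
- 2026-08-23T10:47:02Z · DORMANT — reconciler: no traction for 6 d (last activity item-evidence-added at 2026-08-17T08:39:09Z); parked, not closed — `ledger route dormant route-PneNP-ArnoldMorseD (operator:999:1916778)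

sub-problem: PneNP · status: dormant · opened planner-plancard-PneNP-PneNP-arnold-torus-hom-9e2c2536-0 2026-08-15T18:40:38Z · rev 6 · ledger route-PneNP-ArnoldMorseDeficit
GENERATED by the gate from the ledger (D-0016/17). Provers cite these decls: `theorem foo : Summit.PneNP.PneNP.Theses.ArnoldMorseDeficit.<Decl> := …` in Summits/PneNP/PneNP/Theorems/<Name>.lean.
-/

namespace Summit.PneNP.PneNP.Theses.ArnoldMorseDeficit

open scoped BigOperators Topology Manifold Classical MeasureTheory ProbabilityTheory Matrix InnerProductSpace ComplexConjugate ContinuousMap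
open Filter Set Function TopologicalSpace MeasureTheory

attribute [summit_statement] _root_.PneNP

open Literature.PNP

/-- item stmt-PneNP-11725 · crux (kind.auto-crux: conjecture-grade) · rank 0 · open · by planner
why it might fail: It is an FP ≠ TFNP statement, so only conditional (crux 2 + CLS ⊄ FP) or restricted-model (cruxes 3, 4) evidence is reachable; false iff unlisted critical cells of every succinct discrete Morse function can be found in poly time, e.g. if one always lies poly-close to Λ.
sources: doi:10.1016/0304-3975(91)90200-l, doi:10.1016/s0022-0000(05)80063-7, doi:10.1006/aima.1997.1650, arXiv:1902.07657, doi:10.1145/3568163, HubacekYogev2020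
[target] X — no g ∈ FP solves MORSE-DEFICIT: for every polynomial-time string function g there is a
valid instance I = (n, m ≥ 1, programs D, list Λ with |Λ| < 2^n) such that g(code I) is not the code
of a solution cell (critical ∧ unlisted, or Morse-violating, or listed ∧ non-critical). Instance
code = ⟨1^n, ⟨1^m, ⟨encList D, encList Λ⟩⟩⟩ (boolPair, unary n and m so that cell codes, of length
n·m + n, are polynomially bounded). -/
@[route_item "route-PneNP-ArnoldMorseDeficit"]
def MorseDeficitHard : Prop :=
  let bp := Literature.Computability.Complexity.boolPair; let ev := Literature.Computability.Complexity.CircEval.evalFn; let el := Literature.Computability.Complexity.encList; let cellBits : (n m : ℕ) → ((Fin n → ℕ) × (Fin n → Bool)) → List Bool := fun n m c => (List.ofFn fun i : Fin n => List.ofFn fun j : Fin m => (c.1 i).testBit j).flatten ++ List.ofFn c.2; let val : (n m : ℕ) → List (List Bool) → ((Fin n → ℕ) × (Fin n → Bool)) → ℕ := fun n m D c => ((List.finRange D.length).map fun j => if ev (bp (cellBits n m c) (D.get j)) = [true] then 2 ^ (j : ℕ) else 0).sum; let facets : (n m : ℕ) → ((Fin n → ℕ) × (Fin n → Bool)) →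 List ((Fin n → ℕ) × (Fin n → Bool)) := fun n m c => (List.finRange n).flatMap fun i => if c.2 i then [(c.1, update c.2 i false), (update c.1 i ((c.1 i + 1) % 2 ^ m), update c.2 i false)] else []; let cofacets : (n m : ℕ) → ((Fin n → ℕ) × (Fin n → Bool)) → List ((Fin n → ℕ) × (Fin n → Bool)) := fun n m c => (List.finRange n).flatMap fun i => if c.2 i then [] else [(c.1, update c.2 i true), (update c.1 i ((c.1 i + 2 ^ m - 1) % 2 ^ m), update c.2 i true)]; let upBad : (n m : ℕ) → List (List Bool) → ((Fin n → ℕ) × (Fin n → Bool)) → ℕ := fun n m D c => ((cofacets n m c).filter fun τ => decide (val n m D τ ≤ val n m D c)).length; let downBad : (n m : ℕ) → List (List Bool) → ((Fin n → ℕ) × (Fin n → Bool)) → ℕ := fun n m D c => ((facets n m c).filter fun ν => decide (val n m D c ≤ val n m D ν)).length; let IsSol : (I : ℕ × ℕ × List (List Bool) × List (List Bool)) → ((Fin I.1 → ℕ) × (Fin I.1 → Bool)) → Prop := fun I c => (∀ i, c.1 i < 2 ^ I.2.1) ∧ (¬ (upBad I.1 I.2.1 I.2.2.1 c ≤ 1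 ∧ downBad I.1 I.2.1 I.2.2.1 c ≤ 1) ∨ (upBad I.1 I.2.1 I.2.2.1 c = 0 ∧ downBad I.1 I.2.1 I.2.2.1 c = 0 ∧ cellBits I.1 I.2.1 c ∉ I.2.2.2) ∨ (¬ (upBad I.1 I.2.1 I.2.2.1 c = 0 ∧ downBad I.1 I.2.1 I.2.2.1 c = 0) ∧ cellBits I.1 I.2.1 c ∈ I.2.2.2)); let Valid : (ℕ × ℕ × List (List Bool) × List (List Bool)) → Prop := fun I => 1 ≤ I.2.1 ∧ I.2.2.2.length < 2 ^ I.1; let encI : (ℕ × ℕ × List (List Bool) × List (List Bool)) → List Bool := fun I => bp (Computability.unaryEncodeNat I.1) (bp (Computability.unaryEncodeNat I.2.1) (bp (el I.2.2.1) (el I.2.2.2))); ¬ ∃ g ∈ Literature.Computability.Complexity.FP, ∀ I, Valid I → ∃ c : (Fin I.1 → ℕ) × (Fin I.1 → Bool), cellBits I.1 I.2.1 c = g (encI I) ∧ IsSol I c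

/-- item stmt-PneNP-11726 · crux · rank 2 · open · by planner
why it might fail: Values must be locally computable (programs D) yet induce ONE acyclic Forman pairing: V orders the corridors, but at groove/background seams, corners and the re-landscaped bowl the product gradient is re-paired locally; an unmatched cell there that ψ cannot decode to an EOPL solution kills it.
sources: arXiv:1811.03841, doi:10.1016/j.jcss.2020.05.007, HubacekYogev2020, doi:10.1145/3568163, arXiv:2202.07761, doi:10.1016/j.tcs.2009.07.052
[crux] CLS-HARDNESS — END-OF-POTENTIAL-LINE (Fearnley–Gordon–Mehta–Savani:
successor/predecessor/potential programs S, P, V on {0,1}^k, P(0^k) = 0^k ≠ S(0^k); solutions: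
S(P(x)) ≠ x ≠ 0^k, or P(S(x)) ≠ x, or an edge x → S(x) with P(S(x)) = x along which V does not
increase) Karp-reduces to MORSE-DEFICIT: there are φ, ψ ∈ FP such that φ maps the code of every
valid EOPL instance to the code of a valid MORSE-DEFICIT instance and ψ maps every solution cell of
the image (paired with the EOPL code) to an EOPL solution. Intended construction: background = a
perfect discrete Morse function on T³_N, Λ = its 7 critical cells other than the minimum; the basin
of the minimum is re-landscaped into a bowl draining into the standard line's groove; lines =
f-decreasing gradient corridors (values from the potential), tails = pits (critical vertices),
non-standard heads = saddle gadgets (critical edges); Euler bookkeeping t pits ⇔ t − 1 new saddles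
matches exactly. Consequence: X ⟸ CLS ⊄ FP. [difficulty: L] -/
@[route_item "route-PneNP-ArnoldMorseDeficit", crux]
def EoplToMorseDeficit : Prop :=
  let bp := Literature.Computability.Complexity.boolPair; let ev := Literature.Computability.Complexity.CircEval.evalFn; let el := Literature.Computability.Complexity.encList; let cellBits : (n m : ℕ) → ((Fin n → ℕ) × (Fin n → Bool)) → List Bool := fun n m c => (List.ofFn fun i : Fin n => List.ofFn fun j : Fin m => (c.1 i).testBit j).flatten ++ List.ofFn c.2; let val : (n m : ℕ) → List (List Bool) → ((Fin n → ℕ) × (Fin n → Bool)) → ℕ := fun n m D c => ((List.finRange D.length).map fun j => if ev (bp (cellBits n m c) (D.get j)) = [true] then 2 ^ (j : ℕ) else 0).sum; let facets : (n m : ℕ) → ((Fin n → ℕ) × (Fin n → Bool)) → List ((Fin n → ℕ) × (Fin n → Bool)) := fun n m c => (List.finRange n).flatMap fun i => if c.2 i then [(c.1, update c.2 i false), (update c.1 i ((c.1 i + 1) % 2 ^ m), update c.2 i false)] else []; let cofacets : (n m : ℕ) → ((Fin n → ℕ) × (Fin n → Bool)) → List ((Fin n → ℕ) × (Fin n → Bool))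 := fun n m c => (List.finRange n).flatMap fun i => if c.2 i then [] else [(c.1, update c.2 i true), (update c.1 i ((c.1 i + 2 ^ m - 1) % 2 ^ m), update c.2 i true)]; let upBad : (n m : ℕ) → List (List Bool) → ((Fin n → ℕ) × (Fin n → Bool)) → ℕ := fun n m D c => ((cofacets n m c).filter fun τ => decide (val n m D τ ≤ val n m D c)).length; let downBad : (n m : ℕ) → List (List Bool) → ((Fin n → ℕ) × (Fin n → Bool)) → ℕ := fun n m D c => ((facets n m c).filter fun ν => decide (val n m D c ≤ val n m D ν)).length; let IsSol : (I : ℕ × ℕ × List (List Bool) × List (List Bool)) → ((Fin I.1 → ℕ) × (Fin I.1 → Bool)) → Prop := fun I c => (∀ i, c.1 i < 2 ^ I.2.1) ∧ (¬ (upBad I.1 I.2.1 I.2.2.1 c ≤ 1 ∧ downBad I.1 I.2.1 I.2.2.1 c ≤ 1) ∨ (upBad I.1 I.2.1 I.2.2.1 c = 0 ∧ downBad I.1 I.2.1 I.2.2.1 c = 0 ∧ cellBits I.1 I.2.1 c ∉ I.2.2.2) ∨ (¬ (upBad I.1 I.2.1 I.2.2.1 c = 0 ∧ downBad I.1 I.2.1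 I.2.2.1 c = 0) ∧ cellBits I.1 I.2.1 c ∈ I.2.2.2)); let Valid : (ℕ × ℕ × List (List Bool) × List (List Bool)) → Prop := fun I => 1 ≤ I.2.1 ∧ I.2.2.2.length < 2 ^ I.1; let encI : (ℕ × ℕ × List (List Bool) × List (List Bool)) → List Bool := fun I => bp (Computability.unaryEncodeNat I.1) (bp (Computability.unaryEncodeNat I.2.1) (bp (el I.2.2.1) (el I.2.2.2))); let EB : List (List Bool) → List Bool → List Bool := fun P w => P.map fun d => decide (ev (bp w d) = [true]); let toNat : List Bool → ℕ := fun w => ((List.finRange w.length).map fun j => if w.get j then 2 ^ (j : ℕ) else 0).sum; let zero : ℕ → List Bool := fun k => List.replicate k false; let SolE : ℕ → List (List Bool) → List (List Bool) → List (List Bool) → List Bool → Prop := fun k S P V x => x.length = k ∧ ((EB S (EB P x) ≠ x ∧ x ≠ zero k) ∨ EB P (EB S x) ≠ x ∨ (EB S x ≠ x ∧ EB P (EB S x) = x ∧ toNat (EB V (EB S x)) ≤ toNat (EB V x))); let encE : ℕ → List (List Bool) → List (List Bool) → List (List Bool) → List Bool := fun k S P V => bp (Computability.unaryEncodeNat k)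 (bp (el S) (bp (el P) (el V))); ∃ φ ∈ Literature.Computability.Complexity.FP, ∃ ψ ∈ Literature.Computability.Complexity.FP, ∀ (k : ℕ) (S P V : List (List Bool)), 1 ≤ k → S.length = k → P.length = k → EB P (zero k) = zero k → EB S (zero k) ≠ zero k → ∃ I : ℕ × ℕ × List (List Bool) × List (List Bool), encI I = φ (encE k S P V) ∧ Valid I ∧ ∀ c : (Fin I.1 → ℕ) × (Fin I.1 → Bool), IsSol I c → SolE k S P V (ψ (bp (encE k S P V) (cellBits I.1 I.2.1 c)))

/-- item stmt-PneNP-11727 · crux · rank 3 · open · by planner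
why it might fail: False iff MD^dt(T^3, flag) lies in PLS^dt (BKT14/GKRS19/BFI23): e.g. a bounded-memory Prover (Atserias-Dalmau width game) walking the separatrices of the listed edge/square with a local exit rule that gets past down-paired dead ends; and expansion-based (BSW) width bounds may miss homological rank.
sources: doi:10.4230/lipics.itcs.2023.30, GoosKamathRobereSokolov2019, arXiv:2205.02168, doi:10.1017/jsl.2013.37, BenSassonWigderson2001, AtseriasDalmau2008
[crux] NOT A POTENTIAL ARGUMENT — the Morse tautologies on T³ in the balanced regime need
super-polylogarithmic Resolution width: for every a there is m₀ such that for all m ≥ m₀ every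
Resolution refutation of MorseCNF(m) has width > m^a. MorseCNF(m): variables x_(c,j) = bit j < 3m+3
of f(c), c a cell of the cubical T³ with N = 2^m; for every cell c one clause excluding each
assignment of the 7(3m+3) variables of c and its 6 incident cells that violates "f is discrete-Morse
at c ∧ (c ∈ Λ₀ ↔ c is critical)", Λ₀ = the origin flag (vertex 0, edge 0+[0,1]e₀, square, cube);
unsatisfiable for m ≥ 1 since b₁(T³; 𝔽₂) = 3 forces ≥ 3 critical edges while Euler characteristic
and min/max search force nothing. By the TFNP^dt dictionary (PLS^dt = polylog-width Resolution) this
says MORSE-DEFICIT^dt(T³, Λ₀) ∉ PLS^dt although every V-path descends. [difficulty: L] -/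
@[route_item "route-PneNP-ArnoldMorseDeficit"]
def MorseTautResWidth : Prop :=
  ∀ a : ℕ, ∃ m₀ : ℕ, ∀ m ≥ m₀, let sh : Fin (2 ^ m) → Fin (2 ^ m) := fun x => ⟨((x : ℕ) + 1) % 2 ^ m, Nat.mod_lt _ (Nat.two_pow_pos m)⟩; let us : Fin (2 ^ m) → Fin (2 ^ m) := fun x => ⟨((x : ℕ) + 2 ^ m - 1) % 2 ^ m, Nat.mod_lt _ (Nat.two_pow_pos m)⟩; let facets : ((Fin 3 → Fin (2 ^ m)) × (Fin 3 → Bool)) → List ((Fin 3 → Fin (2 ^ m)) × (Fin 3 → Bool)) := fun c => (List.finRange 3).flatMap fun i => if c.2 i then [(c.1, update c.2 i false), (update c.1 i (sh (c.1 i)), update c.2 i false)] else []; let cofacets : ((Fin 3 → Fin (2 ^ m)) × (Fin 3 → Bool)) → List ((Fin 3 → Fin (2 ^ m)) × (Fin 3 → Bool)) := fun c => (List.finRange 3).flatMap fun i => if c.2 i then [] else [(c.1, update c.2 i true), (update c.1 i (us (c.1 i)), update c.2 i true)]; let morse : (((Fin 3 → Fin (2 ^ m)) × (Fin 3 → Bool))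 → ℕ) → ((Fin 3 → Fin (2 ^ m)) × (Fin 3 → Bool)) → Prop := fun f c => ((cofacets c).filter fun τ => decide (f τ ≤ f c)).length ≤ 1 ∧ ((facets c).filter fun ν => decide (f c ≤ f ν)).length ≤ 1; let crit : (((Fin 3 → Fin (2 ^ m)) × (Fin 3 → Bool)) → ℕ) → ((Fin 3 → Fin (2 ^ m)) × (Fin 3 → Bool)) → Prop := fun f c => (∀ τ ∈ cofacets c, f c < f τ) ∧ (∀ ν ∈ facets c, f ν < f c); let o : Fin 3 → Fin (2 ^ m) := fun _ => ⟨0, Nat.two_pow_pos m⟩; let Λ₀ : List ((Fin 3 → Fin (2 ^ m)) × (Fin 3 → Bool)) := [(o, ![false, false, false]), (o, ![true, false, false]), (o, ![true, true, false]), (o, ![true, true, true])]; let val : ((((Fin 3 → Fin (2 ^ m)) × (Fin 3 → Bool)) × Fin (3 * m + 3)) → Bool) → ((Fin 3 → Fin (2 ^ m)) × (Fin 3 → Bool)) → ℕ := fun α c => ((List.finRange (3 * m + 3)).map fun j => if α (c, j) then 2 ^ (j : ℕ) else 0).sum; let good : ((((Fin 3 → Fin (2 ^ m)) × (Fin 3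 → Bool)) × Fin (3 * m + 3)) → Bool) → ((Fin 3 → Fin (2 ^ m)) × (Fin 3 → Bool)) → Prop := fun α c => morse (val α) c ∧ (c ∈ Λ₀ ↔ crit (val α) c); let block : ((Fin 3 → Fin (2 ^ m)) × (Fin 3 → Bool)) → List (((Fin 3 → Fin (2 ^ m)) × (Fin 3 → Bool)) × Fin (3 * m + 3)) := fun c => (c :: (facets c ++ cofacets c)).flatMap fun d => (List.finRange (3 * m + 3)).map fun j => (d, j); let assign : ((Fin 3 → Fin (2 ^ m)) × (Fin 3 → Bool)) → ℕ → ((((Fin 3 → Fin (2 ^ m)) × (Fin 3 → Bool)) × Fin (3 * m + 3)) → Bool) := fun c t x => t.testBit ((block c).idxOf x); let cnf : Literature.Computability.Complexity.CNF (((Fin 3 → Fin (2 ^ m)) × (Fin 3 → Bool)) × Fin (3 * m + 3)) := (Finset.univ : Finset ((Fin 3 → Fin (2 ^ m)) × (Fin 3 → Bool))).toList.flatMap fun c => ((List.range (2 ^ (block c).length)).filter fun t => decide ¬ good (assign c t) c).map fun t => (block c).map fun x => (x, !(assign c t x)); ∀ π, Literature.Computability.MetaComplexity.IsResRefutation cnf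 π → m ^ a < Literature.Computability.MetaComplexity.resWidth π

/-- item stmt-PneNP-11728 · crux · rank 4 · open · by planner
why it might fail: Over F2 the refutation IS linear algebra: algebraic Morse theory (Kozlov Thm 11.24) kills matched pairs one by one in f-order; if that localises (short effective V-paths) or a PPA^dt walk exists (parity exits on a double cover), NS/PC degree is polylog; IPS99-type degree bounds are unknown here.
sources: GoosKamathRobereSokolov2019, doi:10.1006/jcss.1998.1575, arXiv:2205.02168, ImpagliazzoPudlakSgall1999, doi:10.1016/j.apal.2012.01.015, doi:10.4230/lipics.itcs.2023.30
[crux] NOT A PARITY ARGUMENT — for every a there is m₀ such that for all m ≥ m₀ the clause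
polynomials of MorseCNF(m) (clause C ↦ Π_(x,b)∈C (b ? 1 − x : x), Boolean axioms free) have no
polynomial-calculus refutation over 𝔽₂ of degree ≤ m^a; a fortiori no polylog-degree
𝔽₂-Nullstellensatz refutation, i.e. MORSE-DEFICIT^dt(T³, Λ₀) ∉ PPA^dt ⊇ PPAD^dt ⊇ CLS^dt by the
dictionary. With crux 3: homological-rank totality is reducible to neither potential nor parity
arguments in the black-box world — the provable content of "new species" (the refuter's PPA flag,
settled in the right arena). [difficulty: L] -/
@[route_item "route-PneNP-ArnoldMorseDeficit"]
def MorseTautPCDegree : Prop :=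
  ∀ a : ℕ, ∃ m₀ : ℕ, ∀ m ≥ m₀, let sh : Fin (2 ^ m) → Fin (2 ^ m) := fun x => ⟨((x : ℕ) + 1) % 2 ^ m, Nat.mod_lt _ (Nat.two_pow_pos m)⟩; let us : Fin (2 ^ m) → Fin (2 ^ m) := fun x => ⟨((x : ℕ) + 2 ^ m - 1) % 2 ^ m, Nat.mod_lt _ (Nat.two_pow_pos m)⟩; let facets : ((Fin 3 → Fin (2 ^ m)) × (Fin 3 → Bool)) → List ((Fin 3 → Fin (2 ^ m)) × (Fin 3 → Bool)) := fun c => (List.finRange 3).flatMap fun i => if c.2 i then [(c.1, update c.2 i false), (update c.1 i (sh (c.1 i)), update c.2 i false)] else []; let cofacets : ((Fin 3 → Fin (2 ^ m)) × (Fin 3 → Bool)) → List ((Fin 3 → Fin (2 ^ m)) × (Fin 3 → Bool)) := fun c => (List.finRange 3).flatMap fun i => if c.2 i then [] else [(c.1, update c.2 i true), (update c.1 i (us (c.1 i)), update c.2 i true)]; let morse : (((Fin 3 → Fin (2 ^ m)) × (Fin 3 → Bool)) → ℕ) → ((Fin 3 → Fin (2 ^ m)) × (Fin 3 → Bool)) →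 Prop := fun f c => ((cofacets c).filter fun τ => decide (f τ ≤ f c)).length ≤ 1 ∧ ((facets c).filter fun ν => decide (f c ≤ f ν)).length ≤ 1; let crit : (((Fin 3 → Fin (2 ^ m)) × (Fin 3 → Bool)) → ℕ) → ((Fin 3 → Fin (2 ^ m)) × (Fin 3 → Bool)) → Prop := fun f c => (∀ τ ∈ cofacets c, f c < f τ) ∧ (∀ ν ∈ facets c, f ν < f c); let o : Fin 3 → Fin (2 ^ m) := fun _ => ⟨0, Nat.two_pow_pos m⟩; let Λ₀ : List ((Fin 3 → Fin (2 ^ m)) × (Fin 3 → Bool)) := [(o, ![false, false, false]), (o, ![true, false, false]), (o, ![true, true, false]), (o, ![true, true, true])]; let val : ((((Fin 3 → Fin (2 ^ m)) × (Fin 3 → Bool)) × Fin (3 * m + 3)) → Bool) → ((Fin 3 → Fin (2 ^ m)) × (Fin 3 → Bool)) → ℕ := fun α c => ((List.finRange (3 * m + 3)).map fun j => if α (c, j) then 2 ^ (j : ℕ) else 0).sum; let good : ((((Fin 3 → Fin (2 ^ m)) × (Fin 3 → Bool)) × Fin (3 * m + 3)) → Bool) → ((Fin 3 → Fin (2 ^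 m)) × (Fin 3 → Bool)) → Prop := fun α c => morse (val α) c ∧ (c ∈ Λ₀ ↔ crit (val α) c); let block : ((Fin 3 → Fin (2 ^ m)) × (Fin 3 → Bool)) → List (((Fin 3 → Fin (2 ^ m)) × (Fin 3 → Bool)) × Fin (3 * m + 3)) := fun c => (c :: (facets c ++ cofacets c)).flatMap fun d => (List.finRange (3 * m + 3)).map fun j => (d, j); let assign : ((Fin 3 → Fin (2 ^ m)) × (Fin 3 → Bool)) → ℕ → ((((Fin 3 → Fin (2 ^ m)) × (Fin 3 → Bool)) × Fin (3 * m + 3)) → Bool) := fun c t x => t.testBit ((block c).idxOf x); let cnf : Literature.Computability.Complexity.CNF (((Fin 3 → Fin (2 ^ m)) × (Fin 3 → Bool)) × Fin (3 * m + 3)) := (Finset.univ : Finset ((Fin 3 → Fin (2 ^ m)) × (Fin 3 → Bool))).toList.flatMap fun c => ((List.range (2 ^ (block c).length)).filter fun t => decide ¬ good (assign c t) c).map fun t => (block c).map fun x => (x, !(assign c t x)); let polyOf : Literature.Computability.Complexity.Clause (((Fin 3 → Fin (2 ^ m)) × (Fin 3 → Bool)) × Fin (3 * m + 3)) → MvPolynomial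 (((Fin 3 → Fin (2 ^ m)) × (Fin 3 → Bool)) × Fin (3 * m + 3)) (ZMod 2) := fun C => (C.map fun l => if l.2 then 1 - MvPolynomial.X l.1 else MvPolynomial.X l.1).prod; ¬ Literature.Computability.MetaComplexity.PC.RefutableInDegree (polyOf '' {C | C ∈ cnf}) (m ^ a)

-- earlier EoplHard (stmt-PneNP-18975, replaced 2026-08-17T03:45:48Z -> stmt-PneNP-19068): retired by None — ¬ Literature.Computability.Complexity.TFNP.EndOfPotentialLine.SolvableInFP
/-- item stmt-PneNP-19068 · crux · rank 6 · open · by planner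
why it might fail: It is CLS ⊄ FP, an unproved hypothesis ≥ P ≠ NP in strength: false iff END-OF-POTENTIAL-LINE (equivalently KKT points of gradient descent, FGHS 2022) has a poly-time algorithm; only cryptographic (IS + Fiat–Shamir, iO+OWF) and oracle evidence exists.
sources: arXiv:1811.03841, doi:10.1145/3568163, arXiv:2202.07761, doi:10.1145/3313276.3316400, HubacekYogev2020, doi:10.1016/0304-3975(91)90200-l
[crux] EOPL ⊄ FP — END-OF-POTENTIAL-LINE (Fearnley–Gordon–Mehta–Savani 2020, Def. 9: S, P, V on
{0,1}^n with P(0^n) = 0^n ≠ S(0^n), V(0^n) = 0; find an R1 end-of-line point or an R2 edge along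
which V does not increase) is NOT solvable in polynomial time: no g ∈ FP returns a solution on the
code ⟨1^n, encList [encList S, encList P, encList V]⟩ of every valid instance — `¬
SearchProblem.SolvableInFP TFNP.EndOfPotentialLine` over the Literature vocabulary of
TotalSearchProblem.lean / TFNPProblems.lean. ROUTE-REPAIR 2026-08-17: restated 1:1 from the
dot-notation spelling `¬ TFNP.EndOfPotentialLine.SolvableInFP` — the SAME proposition definitionally
(field notation unfolded) — so that the route file imports
`Literature.Computability.Complexity.TFNPProblems` instead of `…TFNPClasses`, whose unproved named
fact `EOPL_eq_PLS_inter_PPAD` (GHJMPRT 2022 Thm 1) no item of this route uses; provers landing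
MorseDeficitHardOfEopl / EoplToMorseDeficit should likewise import TFNPProblems (EndOfPotentialLine,
instCode, evalBits, ofCircuits API) rather than TFNPClasses. EOPL-hardness is used directly; the
identification EOPL = CLS = PPAD ∩ PLS (FGHS 2022 Thm 1.1; GHJMPRT 2022 Thm 1) is commentary na -/
@[route_item "route-PneNP-ArnoldMorseDeficit", crux]
def EoplHard : Prop :=
  ¬ Literature.Computability.Complexity.SearchProblem.SolvableInFP Literature.Computability.Complexity.TFNP.EndOfPotentialLine

-- item stmt-PneNP-11869 · support · rank 5 · open · by planner — informal only, no Lean statement yet: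
--   [crux] ARNOLD ↔ MORSE dictionary made effective (card arnold-torus-homological-totality, its K3
--   direction + title object). ARNOLD-TORUS_ε: given k gradient-Feistel rounds on T^{2n} = (ℝ/ℤ)^{2n} —
--   shears (x,y) ↦ (x, y + ∇V_i(x)), (x,y) ↦ (x + ∇W_i(y), y) with V_i, W_i periodic, given by
--   B₂-programs over dyadic fixed-point arithmetic with a Lipschitz bound read off the syntax — and ε =
--   2^{-p}, find z with |F(z) − z| ≤ ε (total by Conley–Zehnder 1983 Thm 1: every Hamiltonian
--   diffeomorphism of T^{2n} has ≥ 2n+1 fixed points; F is Hamiltonian as a composition of time-1 maps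
--   of H = V_i(x), H = −W_i(

/-- item stmt-PneNP-11729 · support · rank 9 · open · by planner
sources: doi:10.1006/aima.1997.1650, doi:10.1142/9360, doi:10.1016/s0012-365x(99)00258-7
[support] TOTALITY — every valid instance has a solution: if no valid cell violates Forman's
condition then f is a discrete Morse function on the cubical complex of T^n_(2^m) (regular CW for m
≥ 1), so #critical cells ≥ Σ_k b_k(T^n; 𝔽₂) = 2^n > |Λ| (Forman 1998 Cor. 3.7 weak Morse
inequalities; Künneth), and cell codes are injective on valid cells. Needs cellular homology of the
cubical torus over 𝔽₂ (not in Mathlib) — heavy but classical; it is the existence lemma of the whole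
line. [difficulty: XL] -/
@[route_item "route-PneNP-ArnoldMorseDeficit", crux]
def MorseDeficitTotal : Prop :=
  let bp := Literature.Computability.Complexity.boolPair; let ev := Literature.Computability.Complexity.CircEval.evalFn; let cellBits : (n m : ℕ) → ((Fin n → ℕ) × (Fin n → Bool)) → List Bool := fun n m c => (List.ofFn fun i : Fin n => List.ofFn fun j : Fin m => (c.1 i).testBit j).flatten ++ List.ofFn c.2; let val : (n m : ℕ) → List (List Bool) → ((Fin n → ℕ) × (Fin n → Bool)) → ℕ := fun n m D c => ((List.finRange D.length).map fun j => if ev (bp (cellBits n m c) (D.get j)) = [true] then 2 ^ (j : ℕ) else 0).sum; let facets : (n m : ℕ) → ((Fin n → ℕ) × (Fin n → Bool)) → List ((Fin n → ℕ) × (Fin n → Bool)) := fun n m c => (List.finRange n).flatMap fun i => if c.2 i then [(c.1, update c.2 i false), (update c.1 i ((c.1 i + 1) % 2 ^ m), update c.2 i false)] else []; let cofacets : (n m : ℕ) → ((Fin n → ℕ) × (Fin n → Bool)) → List ((Fin n → ℕ) × (Fin n → Bool)) := fun n m c => (List.finRange n).flatMap fun i => if c.2 i then [] else [(c.1, update c.2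 i true), (update c.1 i ((c.1 i + 2 ^ m - 1) % 2 ^ m), update c.2 i true)]; let upBad : (n m : ℕ) → List (List Bool) → ((Fin n → ℕ) × (Fin n → Bool)) → ℕ := fun n m D c => ((cofacets n m c).filter fun τ => decide (val n m D τ ≤ val n m D c)).length; let downBad : (n m : ℕ) → List (List Bool) → ((Fin n → ℕ) × (Fin n → Bool)) → ℕ := fun n m D c => ((facets n m c).filter fun ν => decide (val n m D c ≤ val n m D ν)).length; let IsSol : (I : ℕ × ℕ × List (List Bool) × List (List Bool)) → ((Fin I.1 → ℕ) × (Fin I.1 → Bool)) → Prop := fun I c => (∀ i, c.1 i < 2 ^ I.2.1) ∧ (¬ (upBad I.1 I.2.1 I.2.2.1 c ≤ 1 ∧ downBad I.1 I.2.1 I.2.2.1 c ≤ 1) ∨ (upBad I.1 I.2.1 I.2.2.1 c = 0 ∧ downBad I.1 I.2.1 I.2.2.1 c = 0 ∧ cellBits I.1 I.2.1 c ∉ I.2.2.2) ∨ (¬ (upBad I.1 I.2.1 I.2.2.1 c = 0 ∧ downBad I.1 I.2.1 I.2.2.1 c = 0) ∧ cellBits I.1 I.2.1 c ∈ I.2.2.2));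 let Valid : (ℕ × ℕ × List (List Bool) × List (List Bool)) → Prop := fun I => 1 ≤ I.2.1 ∧ I.2.2.2.length < 2 ^ I.1; ∀ I, Valid I → ∃ c : (Fin I.1 → ℕ) × (Fin I.1 → Bool), IsSol I c

/-- item stmt-PneNP-11730 · support · rank 9 · open · by planner
sources: AroraBarak2009, Literature.Computability.Complexity.CircEval.evalFn_mem_FP, Literature.Computability.Complexity.mem_P_of_mem_FP
[support] MEMBERSHIP — the solution relation R = {⟨code I, code c⟩ | I valid, c a solution of I} is
in Classes.P: unpair, parse ⟨1^n,⟨1^m,⟨encList D, encList Λ⟩⟩⟩ (reject non-codewords), read c from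
its n·m + n bits, evaluate the |D| programs on c and its ≤ 2n incident cells with the proved
poly-time evaluator (CircEval.evalFn_mem_FP), compare, count, test membership in Λ. Pure
TM/stack-program plumbing in the style of the tree's Com.mem_FP developments. [difficulty: L] -/
@[route_item "route-PneNP-ArnoldMorseDeficit", crux]
def MorseDeficitCheckP : Prop :=
  let bp := Literature.Computability.Complexity.boolPair; let ev := Literature.Computability.Complexity.CircEval.evalFn; let el := Literature.Computability.Complexity.encList; let cellBits : (n m : ℕ) → ((Fin n → ℕ) × (Fin n → Bool)) → List Bool := fun n m c => (List.ofFn fun i : Fin n => List.ofFn fun j : Fin m => (c.1 i).testBit j).flatten ++ List.ofFn c.2; let val : (n m : ℕ) → List (List Bool) → ((Fin n → ℕ) × (Fin n → Bool)) → ℕ := fun n m D c => ((List.finRange D.length).map fun j => if ev (bp (cellBits n m c) (D.get j)) = [true] then 2 ^ (j : ℕ) else 0).sum; let facets : (n m : ℕ) → ((Fin n → ℕ) × (Fin n → Bool)) → List ((Fin n → ℕ) × (Fin n → Bool)) := fun n m c => (List.finRange n).flatMap fun i => if c.2 i then [(c.1, update c.2 i false), (update c.1 i ((c.1 i + 1)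 % 2 ^ m), update c.2 i false)] else []; let cofacets : (n m : ℕ) → ((Fin n → ℕ) × (Fin n → Bool)) → List ((Fin n → ℕ) × (Fin n → Bool)) := fun n m c => (List.finRange n).flatMap fun i => if c.2 i then [] else [(c.1, update c.2 i true), (update c.1 i ((c.1 i + 2 ^ m - 1) % 2 ^ m), update c.2 i true)]; let upBad : (n m : ℕ) → List (List Bool) → ((Fin n → ℕ) × (Fin n → Bool)) → ℕ := fun n m D c => ((cofacets n m c).filter fun τ => decide (val n m D τ ≤ val n m D c)).length; let downBad : (n m : ℕ) → List (List Bool) → ((Fin n → ℕ) × (Fin n → Bool)) → ℕ := fun n m D c => ((facets n m c).filter fun ν => decide (val n m D c ≤ val n m D ν)).length; let IsSol : (I : ℕ × ℕ × List (List Bool) × List (List Bool)) → ((Fin I.1 → ℕ) × (Fin I.1 → Bool)) → Prop := fun I c => (∀ i, c.1 i < 2 ^ I.2.1) ∧ (¬ (upBad I.1 I.2.1 I.2.2.1 c ≤ 1 ∧ downBad I.1 I.2.1 I.2.2.1 c ≤ 1) ∨ (upBad I.1 I.2.1 I.2.2.1 c = 0 ∧ downBad I.1 I.2.1 I.2.2.1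 c = 0 ∧ cellBits I.1 I.2.1 c ∉ I.2.2.2) ∨ (¬ (upBad I.1 I.2.1 I.2.2.1 c = 0 ∧ downBad I.1 I.2.1 I.2.2.1 c = 0) ∧ cellBits I.1 I.2.1 c ∈ I.2.2.2)); let Valid : (ℕ × ℕ × List (List Bool) × List (List Bool)) → Prop := fun I => 1 ≤ I.2.1 ∧ I.2.2.2.length < 2 ^ I.1; let encI : (ℕ × ℕ × List (List Bool) × List (List Bool)) → List Bool := fun I => bp (Computability.unaryEncodeNat I.1) (bp (Computability.unaryEncodeNat I.2.1) (bp (el I.2.2.1) (el I.2.2.2))); {z : List Bool | ∃ I : ℕ × ℕ × List (List Bool) × List (List Bool), ∃ c : (Fin I.1 → ℕ) × (Fin I.1 → Bool), z = bp (encI I) (cellBits I.1 I.2.1 c) ∧ Valid I ∧ IsSol I c} ∈ Literature.Computability.Complexity.Classes.P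

/-- item stmt-PneNP-11731 · support · rank 9 · open · by planner
why it might fail: Fails if every discrete Morse function on T³ with the flag critical has an unlisted critical cell within poly(m) V-path steps of the separatrices of the listed edge and square (then follow them).
sources: doi:10.1137/17m1118014, doi:10.1016/0166-218x(89)90025-5, doi:10.1007/s00453-008-9169-z, doi:10.1214/aop/1176993605
[support] FIRST RUNG (special case of the spirit of crux 3, in the decision-tree model): there is κ
> 0 such that for all large m every adaptive query algorithm that reads Λ₀ for free, queries at most
2^(κm) values of f on cells of T³_(2^m) and outputs a cell fails, on some discrete Morse function f
with the flag Λ₀ critical, to output an unlisted critical cell. An adversary ("hide the saddles")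
argument extending local-search lower bounds to the regime where min and max are known; the cheapest
theorem of the line and its cheapest falsifier arena. [difficulty: M] -/
@[route_item "route-PneNP-ArnoldMorseDeficit"]
def MorseDeficitQueryDepth : Prop :=
  ∃ κ : ℝ, 0 < κ ∧ ∃ m₀ : ℕ, ∀ m ≥ m₀, let sh : Fin (2 ^ m) → Fin (2 ^ m) := fun x => ⟨((x : ℕ) + 1) % 2 ^ m, Nat.mod_lt _ (Nat.two_pow_pos m)⟩; let us : Fin (2 ^ m) → Fin (2 ^ m) := fun x => ⟨((x : ℕ) + 2 ^ m - 1) % 2 ^ m, Nat.mod_lt _ (Nat.two_pow_pos m)⟩; let facets : ((Fin 3 → Fin (2 ^ m)) × (Fin 3 → Bool)) → List ((Fin 3 → Fin (2 ^ m)) × (Fin 3 → Bool)) := fun c => (List.finRange 3).flatMap fun i => if c.2 i then [(c.1, update c.2 i false), (update c.1 i (sh (c.1 i)), update c.2 i false)] else []; let cofacets : ((Fin 3 → Fin (2 ^ m)) × (Fin 3 → Bool)) → List ((Fin 3 → Fin (2 ^ m)) × (Fin 3 → Bool)) := fun c => (List.finRange 3).flatMap fun i => if c.2 i then [] else [(c.1,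 update c.2 i true), (update c.1 i (us (c.1 i)), update c.2 i true)]; let morse : (((Fin 3 → Fin (2 ^ m)) × (Fin 3 → Bool)) → ℕ) → ((Fin 3 → Fin (2 ^ m)) × (Fin 3 → Bool)) → Prop := fun f c => ((cofacets c).filter fun τ => decide (f τ ≤ f c)).length ≤ 1 ∧ ((facets c).filter fun ν => decide (f c ≤ f ν)).length ≤ 1; let crit : (((Fin 3 → Fin (2 ^ m)) × (Fin 3 → Bool)) → ℕ) → ((Fin 3 → Fin (2 ^ m)) × (Fin 3 → Bool)) → Prop := fun f c => (∀ τ ∈ cofacets c, f c < f τ) ∧ (∀ ν ∈ facets c, f ν < f c); let o : Fin 3 → Fin (2 ^ m) := fun _ => ⟨0, Nat.two_pow_pos m⟩; let Λ₀ : List ((Fin 3 → Fin (2 ^ m)) × (Fin 3 → Bool)) := [(o, ![false, false, false]), (o, ![true, false, false]), (o, ![true, true, false]), (o, ![true, true, true])]; ∀ (next out : List ℕ → (Fin 3 → Fin (2 ^ m)) × (Fin 3 → Bool)) (q : ℕ), (q : ℝ) ≤ (2 : ℝ) ^ (κ * m) → ∃ f : ((Fin 3 → Fin (2 ^ m)) ×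 (Fin 3 → Bool)) → ℕ, (∀ c, morse f c) ∧ (∀ c ∈ Λ₀, crit f c) ∧ ¬ (crit f (out ((List.range q).foldl (fun h _ => h ++ [f (next h)]) [])) ∧ out ((List.range q).foldl (fun h _ => h ++ [f (next h)]) []) ∉ Λ₀)

/-- item stmt-PneNP-18998 · support · rank 9 · open · by planner
sources: doi:10.1016/s0022-0000(05)80063-7, doi:10.1145/3568163, Literature.Computability.Complexity.SearchProblem.SolvableInFP.of_manyOneReducible
[support · glue of the split MorseDeficitHard ⟸ EoplToMorseDeficit ∧ EoplHard] Hardness of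
MORSE-DEFICIT from EOPL-hardness along the Karp reduction (Papadimitriou 1994 §2 Prop. 1; FGHS 2022
§3.1.1), across the route's EOPL coding ⟨1^k,⟨encList S,⟨encList P, encList V⟩⟩⟩ / EB / Σ-bits and
the Literature's TFNP.instCode / evalBits / bitsToNat: a poly-time re-coder r (pair projections +
fan-outs), EB = evalBits, Σ_j [w_j]2^j = bitsToNat w, 1 ≤ k from S(0^k) ≠ 0^k, and the solver ψ ∘
⟨r, g ∘ φ ∘ r⟩ ∈ FP. PROVED: Summit.PneNP.PneNP.Theorems.morseDeficitHard_of_subs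
(Cruxes/MorseDeficitHard/Split.lean; evidence on stmt-PneNP-11725) — land verbatim. [difficulty: S,
done] -/
@[route_item "route-PneNP-ArnoldMorseDeficit", crux]
def MorseDeficitHardOfEopl : Prop :=
  EoplToMorseDeficit → EoplHard → MorseDeficitHard

/-- item stmt-PneNP-11732 · assembly · rank 1 · closed · proved by Summit.PneNP.PneNP.Theorems.arnoldMorseDeficit_assembly_proof @ 044a0e7a6d91 (prover) · by planner
sources: Literature.Computability.Complexity.exists_searchFn_of_NP_subset_P, Literature.Computability.Complexity.P_bool_eq_holds, Literature.Computability.Complexity.NP_bool_eq_holds, AroraBarak2009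
[assembly] MorseDeficitTotal → MorseDeficitCheckP → MorseDeficitHard → PneNP (search-to-decision
under P = NP, Arora–Barak Thm 2.18, on the tree's proved exists_searchFn_of_NP_subset_P and the
Wave0 bridges). -/
@[route_item "route-PneNP-ArnoldMorseDeficit", crux]
def Assembly : Prop :=
  MorseDeficitTotal → MorseDeficitCheckP → MorseDeficitHard → _root_.PneNP

/-! D-0027 §2.1 — DECIDING THEOREM (planner-authored via `route open/edit --closes-file`; by planner-cstrat-stmt-PneNP-11725-r1-0 2026-08-17T03:13:57Z):
its hypotheses are this route's items and its conclusion the sub-problem Statement (glue_lint), and it elaborates with this file. -/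

@[closes "route-PneNP-ArnoldMorseDeficit"] theorem closes (hT : MorseDeficitTotal) (hC : MorseDeficitCheckP) (hR : EoplToMorseDeficit) (hE : EoplHard)
    (hG : MorseDeficitHardOfEopl) (hA : Assembly) : _root_.PneNP :=
  have hX : MorseDeficitHard := hG hR hE
  hA hT hC hX

end Summit.PneNP.PneNP.Theses.ArnoldMorseDeficit
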